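import Literature.IUT.HodgeArakelov.AbsTopMonoidsGenuineIsometriesProofs
import Literature.AnabelianGeometry.AbsoluteAnabelian.GaloisPadicLogPadicUnits
import HarnessLib

/-!
# [IUTchII] Remark 1.8.1 at the FULLY GENUINE producer, modulo ONE local-class-field-theory identity
# (proof-only; MERGE-MAP row B9 (e))

S. Mochizuki, *Inter-universal Teichmüller theory II*, §1, Remark 1.8.1, kurims manuscript (Dec. 2020) pp. 41–42
[claim: Mochizuki2012, status: disputed] (IUTchII §1 Rmk 1.8.1, kurims pp.41-42): "no automorphism of `O^{×μ}(G)`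
induced by an element of `Aut(G)` [e.g., an element of `G`, regarded as an inner automorphism of `G`] coincides with an
automorphism of `O^{×μ}(G)` induced by an element of `Γ` that has nontrivial image in `ℤ_p^×`.  Indeed, this follows
immediately by observing that the composite with the `p`-adic logarithm of the cyclotomic character of `G` determines [in
light of the definition of `O^×(G)`, in terms of abelianizations of open subgroups of `G` — cf. [AbsTopIII], Proposition
5.8, (i)] a natural surjection `O^{×μ}(G) ↠ ℚ_p`, which [cf., e.g., [AbsAnab], Proposition 1.2.1, (vi)] is
`Aut(G)`-equivariant … and `Γ`-equivariant".  abc-iut cell, layer L6, MERGE-MAP §8 row B9 (e) (the last B9 residual);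
node IUTchII:Rmk1.8.1 (abc-iut-L6-t1's named `Prop` `Rmk181_statement`, FACT-LIST F-0414 «prove or GAP»); row
«B9-E-RMK181-GENUINE-COND», seat abc-iut-L6-d2 (gen 5).

For the fully genuine producer `AbsTopMonoids.genuineOfModelIsm S C ε hΔ hq` (`O^⊳(G) = 𝒪_k̄^⊳`, `O^⊳(σ) =` THE
equivariant lift `liftM(φ_σ)`, `Ism(G)` = print's isometry group, `Ẑ^× ↠ ℤ_p^× ↪ Ism(G)` by `x ↦ x^{χ_p(u)}`):

* `Genuine.zhatOxmu_eq_one_iff`, `actIsm_toIsm_eq_one_iff` — **"nontrivial image in `ℤ_p^×`" made literal**: `γ ∈ Ẑ^×`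
  acts trivially on `O^{×μ}(G)` iff `χ_p(γ) = 1`;
* **`rmk181_genuineOfModelIsm_of_normCompat`** — `Rmk181_statement (genuineOfModelIsm S C ε hΔ hq)` FROM THE SINGLE
  HYPOTHESIS `hN`: «the equivariant lift `liftM(φ)` of every topological automorphism `φ` of `Gal(k̄/k)` preserves the norm
  `N_{k/ℚ_p}` on the units of `k`» — the classical content of print's sentence (the lift on `𝒪_k^×` is
  `Art_k⁻¹ ∘ φ^{ab} ∘ Art_k`, [AbsAnab] Prop. 1.2.1 (iii)/(vii); the cyclotomic character is `Aut(G)`-invariant,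
  Prop. 1.2.1 (vi); and `χ_cyc ∘ Art_k = N_{k/ℚ_p}⁻¹` on `𝒪_k^×`, [Serre, *Local Fields* XIV §7]).  Both halves of `hN`
  are PROVED in the tree in two vocabularies (`Prop121vii.unitsTransport_level` + `galoisMLF_iso_cyclotomicChar_holds`;
  `cyclotomicCharacter_artin_eq_norm_holds`); their bridge is plan/GAP-LEDGER row G-L6d2-1, NOT assumed away here: this
  theorem is a CONDITIONAL discharge (conditional-result), stated with `hN` as an explicit binder.
  PROOF: let `a := χ_p(γ) ≠ 1`; if `[liftM(φ) x] = [x]^a` for all units `x`, then at `x₀ = 1 + p ∈ ℤ_p^× ⊆ 𝒪_k^×`: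
  `liftM(φ) x₀ = u' ∈ 𝒪_k^×` (`G_k`-fixed by equivariance, Galois descent) with `log_k̄ u' = a · log_k̄ x₀ = log_k̄ s'` for
  a `p`-adic unit `s'` (`MLFClosure.exists_padicUnit_log_eq_mul`), so `u'^n = s'^n`; `hN` gives
  `N(u') = N(x₀) = (1+p)^d`, `N(s') = s'^d` (`d = [k : ℚ_p]`), whence `(1+p)^{dn} = s'^{dn}`, `log_k̄ x₀ = log_k̄ s' =
  a · log_k̄ x₀`, `a = 1` (`log_k̄(1+p) ≠ 0`) — contradiction.

HONEST FRAMING: record-only under a disputed claim key; classical `p`-adic analysis + ONE named LCFT hypothesis;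
nothing here bears on [IUTchIII] Cor. 3.12; typed ≠ proved elsewhere.
-/

set_option autoImplicit false

noncomputable section

namespace Literature.IUT.HodgeArakelov

open CategoryTheory ValuativeRel
open scoped ValuativeRel
open Literature.AnabelianGeometry.AbsoluteAnabelian
open Literature.AnabelianGeometry.EtaleTheta
open Literature.NumberTheory.GaloisRepresentations

namespace AbsTopMonoids

namespace Genuine

variable (C : MLFClosure.{0}) [Fact C.residueChar.Prime]

/-- **`γ ∈ Ẑ^×` acts trivially on `O^{×μ} = (𝒪_k̄^⊳)ˣ⧸μ` iff `χ_p(γ) = 1`** ("nontrivial image in `ℤ_p^×`" of Rmk. 1.8.1,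
made literal for the genuine action `zhatOxmu`). [claim: Mochizuki2012, status: disputed] (IUTchII §1 Rmk 1.8.1, kurims p.41) -/
theorem zhatOxmu_eq_one_iff (γ : ZHatUnits) :
    zhatOxmu C γ = 1 ↔ ZHatLevel.padicCharUnits C.residueChar γ = 1 := by
  constructor
  · intro h
    have h1 : C.zpPow (ZHatLevel.padicCharUnits C.residueChar γ) = 1 := by
      apply (MulAut.congr (oxmuBridge C).symm).injective
      rw [map_one]
      exact h
    exact C.zpPow_injective (h1.trans (map_one C.zpPow).symm)
  · intro h
    change (MulAut.congr (oxmuBridge C).symm) (C.zpPow (ZHatLevel.padicCharUnits C.residueChar γ)) = 1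
    rw [h, map_one, map_one]

end Genuine

section Producer

open Genuine

variable (S : ThetaSetting.{0}) (C : MLFClosure.{0}) (ε : S.Gk ≃ₜ* (ModelMLFGaloisData.galois C.k C.K).tmPair.Pi)
  (hΔ : ∀ f : S.PiX ≃ₜ* S.PiX, S.DeltaX.map f.toMulEquiv.toMonoidHom = S.DeltaX)
  (hq : Nonempty (TopGroup.quot S.PiX S.DeltaX ≃ₜ* S.Gk))

/-- At the fully genuine producer: **`γ ∈ Ẑ^×` acts trivially on `O^{×μ}(G)` through `Ism(G)` iff `χ_p(γ) = 1`**.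
[claim: Mochizuki2012, status: disputed] (IUTchII §1 Rmk 1.8.1, kurims p.41) -/
theorem actIsm_toIsm_eq_one_iff (G : IsoClass S.Gk) (γ : ZHatUnits) :
    (genuineOfModelIsm S C ε hΔ hq).actIsm G ((genuineOfModelIsm S C ε hΔ hq).toIsm G γ) = 1 ↔
      haveI := C.fact_residueChar_prime; ZHatLevel.padicCharUnits C.residueChar γ = 1 :=
  haveI := C.fact_residueChar_prime
  zhatOxmu_eq_one_iff C γ

/-- **[IUTchII] Remark 1.8.1 for the fully genuine producer, conditional on ONE LCFT identity `hN`** (norm-preservation on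
base units of the equivariant lifts of automorphisms of `Gal(k̄/k)`; see the module docstring and GAP-LEDGER G-L6d2-1): no
`Aut(G)`-induced automorphism of `O^{×μ}(G)` — `O^⊳(σ) = liftM(φ_σ)` on `(𝒪_k̄^⊳)ˣ⧸μ` — coincides with the action of a
`γ ∈ Ẑ^×` with `χ_p(γ) ≠ 1`. [claim: Mochizuki2012, status: disputed] (IUTchII §1 Rmk 1.8.1, kurims pp.41-42) -/
theorem rmk181_genuineOfModelIsm_of_normCompat [Fact C.residueChar.Prime]
    (hN : letI : Algebra ℚ_[C.residueChar] C.k :=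
        LocalField.padicAlgebra C.k C.residueChar C.valuation_ringChar_lt_one
      ∀ (φ : (ModelMLFGaloisData.galois C.k C.K).tmPair.Pi ≃ₜ* (ModelMLFGaloisData.galois C.k C.K).tmPair.Pi)
        (u u' : C.k) (hu : algebraMap C.k C.K u ∈ nonzeroIntegers C.k C.K), valuation C.k u = 1 →
        ((Genuine.liftM C φ ⟨algebraMap C.k C.K u, hu⟩ : nonzeroIntegers C.k C.K) : C.K) = algebraMap C.k C.K u' →
        Algebra.norm ℚ_[C.residueChar] u' = Algebra.norm ℚ_[C.residueChar] u) :
    Rmk181_statement (genuineOfModelIsm S C ε hΔ hq) := by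
  letI iQk : Algebra ℚ_[C.residueChar] C.k := LocalField.padicAlgebra C.k C.residueChar C.valuation_ringChar_lt_one
  haveI : FiniteDimensional ℚ_[C.residueChar] C.k :=
    Literature.NumberTheory.PAdicHodge.PadicBase.instFiniteDimensional (F := C.k) (p := C.residueChar)
      C.valuation_ringChar_lt_one
  haveI : CharZero C.K := charZero_of_injective_algebraMap (algebraMap C.k C.K).injective
  intro G σ γ hne hall
  -- (1) `a := χ_p(γ) ≠ 1`
  have ha : ZHatLevel.padicCharUnits C.residueChar γ ≠ 1 := fun h => hne ((zhatOxmu_eq_one_iff C γ).mpr h)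
  -- notation
  let φ : (ModelMLFGaloisData.galois C.k C.K).tmPair.Pi ≃ₜ* (ModelMLFGaloisData.galois C.k C.K).tmPair.Pi :=
    Genuine.phiOf C ε σ
  let L : (ModelMLFGaloisData.galois C.k C.K).tmPair.M ≃* (ModelMLFGaloisData.galois C.k C.K).tmPair.M := Genuine.liftM C φ
  -- (2) the hypothesis read through `log_k̄`: `log (L x) = χ_p(γ) · log x` for every unit `x`
  have E1 : ∀ x : (nonzeroIntegers C.k C.K)ˣ,
      C.galoisPadicLog.log ((L (x : nonzeroIntegers C.k C.K) : nonzeroIntegers C.k C.K) : C.K) =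
        C.padicScalar (ZHatLevel.padicChar C.residueChar γ) *
          C.galoisPadicLog.log ((x : nonzeroIntegers C.k C.K) : C.K) := by
    intro x
    have hx := congrArg (fun q => Multiplicative.toAdd (C.logEquiv (oxmuBridge C q))) (hall x)
    change Multiplicative.toAdd (C.logEquiv (oxmuBridge C
        (QuotientGroup.mk (Units.map L.toMonoidHom x)))) =
      Multiplicative.toAdd (C.logEquiv (oxmuBridge C (zhatOxmu C γ (QuotientGroup.mk x)))) at hx
    rw [toAdd_log_zhatOxmu, oxmuBridge_mk, oxmuBridge_mk, MLFClosure.logEquiv_mk, MLFClosure.logEquiv_mk,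
      toAdd_ofAdd, toAdd_ofAdd, coe_unitsBridge, coe_unitsBridge] at hx
    exact hx
  -- (3) `x₀ := 1 + p`, a `p`-adic unit, as a unit of `𝒪_k̄^⊳`
  obtain ⟨s₀, hs₀⟩ := C.isUnit_one_add_residueChar
  have hx₀u : C.padicScalar (s₀ : ℤ_[C.residueChar]) ∈ unitSubmonoid C.k C.K := C.padicScalar_units_mem_unitSubmonoid s₀
  let t : C.k := LocalField.padicRingHom C.k C.residueChar C.valuation_ringChar_lt_one
    ((s₀ : ℤ_[C.residueChar]) : ℚ_[C.residueChar])
  have ht : algebraMap C.k C.K t = C.padicScalar (s₀ : ℤ_[C.residueChar]) := rfl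
  have htv : valuation C.k t = 1 :=
    C.valuation_padicRingHom_units_eq_one C.residueChar C.valuation_ringChar_lt_one s₀
  have htI : algebraMap C.k C.K t ∈ nonzeroIntegers C.k C.K := unitSubmonoid_le_nonzeroIntegers (ht ▸ hx₀u)
  let x₀ : (nonzeroIntegers C.k C.K)ˣ :=
    (ModelMLFGaloisData.unitsEquivUnitSubmonoid C).symm ⟨algebraMap C.k C.K t, ht ▸ hx₀u⟩
  have hx₀ : ((x₀ : nonzeroIntegers C.k C.K) : C.K) = algebraMap C.k C.K t := by
    change ((ModelMLFGaloisData.unitsEquivUnitSubmonoid C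
      ((ModelMLFGaloisData.unitsEquivUnitSubmonoid C).symm ⟨algebraMap C.k C.K t, ht ▸ hx₀u⟩) :
        unitSubmonoid C.k C.K) : C.K) = _
    rw [MulEquiv.apply_symm_apply]
  have hx₀' : (x₀ : nonzeroIntegers C.k C.K) = ⟨algebraMap C.k C.K t, htI⟩ := Subtype.ext hx₀
  -- (4) `L x₀` is `G_k`-fixed (equivariance of THE lift), hence descends to a unit `u'` of `k`
  -- the elements of the model Galois group ARE `k`-algebra automorphisms of `k̄` (definitionally)
  let toAlg : (ModelMLFGaloisData.galois C.k C.K).tmPair.Pi → (C.K ≃ₐ[C.k] C.K) := fun τ => τ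
  have hval : ∀ (τ : (ModelMLFGaloisData.galois C.k C.K).tmPair.Pi) (y : nonzeroIntegers C.k C.K),
      ((τ • y : nonzeroIntegers C.k C.K) : C.K) = toAlg τ (y : C.K) := fun _ _ => rfl
  have hfix : ∀ τ : (ModelMLFGaloisData.galois C.k C.K).tmPair.Pi,
      τ • L (x₀ : nonzeroIntegers C.k C.K) = L (x₀ : nonzeroIntegers C.k C.K) := by
    intro τ
    have h1 : φ.symm τ • (x₀ : nonzeroIntegers C.k C.K) = (x₀ : nonzeroIntegers C.k C.K) := by
      apply Subtype.ext
      rw [hval, hx₀]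
      exact AlgEquiv.commutes (toAlg (φ.symm τ)) t
    have h2 := Genuine.liftM_spec C φ (φ.symm τ) (x₀ : nonzeroIntegers C.k C.K)
    rw [h1, ContinuousMulEquiv.apply_symm_apply] at h2
    exact h2.symm
  have hLu : ((L (x₀ : nonzeroIntegers C.k C.K) : nonzeroIntegers C.k C.K) : C.K) ∈ unitSubmonoid C.k C.K :=
    (ModelMLFGaloisData.unitsEquivUnitSubmonoid C (Units.map L.toMonoidHom x₀)).2
  have hLinv : ((L (x₀ : nonzeroIntegers C.k C.K) : nonzeroIntegers C.k C.K) : C.K) ∈ invariantUnits C.k C.K := by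
    refine ⟨hLu, fun τ => ?_⟩
    exact congrArg (fun y : nonzeroIntegers C.k C.K => (y : C.K)) (hfix τ)
  obtain ⟨u', hu'v, hu'eq⟩ := C.mem_invariantUnits_iff.mp hLinv
  -- (5) the LCFT input: `N(u') = N(t)`
  have hLt : ((Genuine.liftM C φ ⟨algebraMap C.k C.K t, htI⟩ : nonzeroIntegers C.k C.K) : C.K) = algebraMap C.k C.K u' := by
    rw [← hx₀']
    exact hu'eq.symm
  have hNorm : Algebra.norm ℚ_[C.residueChar] u' = Algebra.norm ℚ_[C.residueChar] t := hN φ t u' htI htv hLt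
  -- (6) `log u' = χ_p(γ) · log x₀ = log s'` for a `p`-adic unit `s'`
  have E1x : C.galoisPadicLog.log (algebraMap C.k C.K u') =
      C.padicScalar (ZHatLevel.padicChar C.residueChar γ) * C.galoisPadicLog.log (C.padicScalar (s₀ : ℤ_[C.residueChar])) := by
    rw [hu'eq, ← ht, ← hx₀]
    exact E1 x₀
  obtain ⟨s', hs'⟩ := C.exists_padicUnit_log_eq_mul s₀ (ZHatLevel.padicChar C.residueChar γ)
  have hlogeq : C.galoisPadicLog.log (algebraMap C.k C.K u') =
      C.galoisPadicLog.log (C.padicScalar (s' : ℤ_[C.residueChar])) := by rw [hs', E1x]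
  -- (7) hence `u'` and `s'` differ by a root of unity: `u'^n = s'^n`
  have hu'U : algebraMap C.k C.K u' ∈ unitSubmonoid C.k C.K := hu'eq ▸ hLu
  have hs'U : C.padicScalar (s' : ℤ_[C.residueChar]) ∈ unitSubmonoid C.k C.K := C.padicScalar_units_mem_unitSubmonoid s'
  have hs'0 : C.padicScalar (s' : ℤ_[C.residueChar]) ≠ 0 := ne_zero_of_mem_unitSubmonoid hs'U
  have hinvU : (C.padicScalar (s' : ℤ_[C.residueChar]))⁻¹ ∈ unitSubmonoid C.k C.K := inv_mem_unitSubmonoid hs'U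
  have hlog1 : C.galoisPadicLog.log (1 : C.K) = 0 :=
    C.galoisPadicLog.log_eq_zero_of_pow_eq_one (unitSubmonoid C.k C.K).one_mem one_pos (one_pow 1)
  have hinv : C.galoisPadicLog.log (C.padicScalar (s' : ℤ_[C.residueChar]))⁻¹ =
      -C.galoisPadicLog.log (C.padicScalar (s' : ℤ_[C.residueChar])) := by
    have h1 := C.galoisPadicLog.log_mul _ hs'U _ hinvU
    rw [mul_inv_cancel₀ hs'0, hlog1] at h1
    exact eq_neg_of_add_eq_zero_right h1.symm
  have hquot : C.galoisPadicLog.log (algebraMap C.k C.K u' * (C.padicScalar (s' : ℤ_[C.residueChar]))⁻¹) = 0 := by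
    rw [C.galoisPadicLog.log_mul _ hu'U _ hinvU, hlogeq, hinv, add_neg_cancel]
  obtain ⟨n, hn, hpow⟩ := (C.galoisPadicLog.log_eq_zero_iff _
    ((unitSubmonoid C.k C.K).mul_mem hu'U (inv_mem_unitSubmonoid hs'U))).mp hquot
  have hpow' : (algebraMap C.k C.K u') ^ n = (C.padicScalar (s' : ℤ_[C.residueChar])) ^ n := by
    rw [mul_pow, inv_pow, mul_inv_eq_one₀ (pow_ne_zero n hs'0)] at hpow
    exact hpow
  -- (8) in `k`: `u'^n = ι₀(s')^n`, so `N(u')^n = (s'^d)^n`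
  have hs'k : C.padicScalar (s' : ℤ_[C.residueChar]) =
      algebraMap C.k C.K (algebraMap ℚ_[C.residueChar] C.k ((s' : ℤ_[C.residueChar]) : ℚ_[C.residueChar])) := rfl
  have hk : u' ^ n = (algebraMap ℚ_[C.residueChar] C.k ((s' : ℤ_[C.residueChar]) : ℚ_[C.residueChar])) ^ n := by
    apply (algebraMap C.k C.K).injective
    rw [map_pow, map_pow, hpow', hs'k]
  have hNs : Algebra.norm ℚ_[C.residueChar] u' ^ n =
      (((s' : ℤ_[C.residueChar]) : ℚ_[C.residueChar]) ^ Module.finrank ℚ_[C.residueChar] C.k) ^ n := by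
    rw [← map_pow, hk, map_pow, Algebra.norm_algebraMap]
  -- (9) `N(t) = s₀^d`; so `s₀^{dn} = s'^{dn}`
  have hNt : Algebra.norm ℚ_[C.residueChar] t =
      ((s₀ : ℤ_[C.residueChar]) : ℚ_[C.residueChar]) ^ Module.finrank ℚ_[C.residueChar] C.k :=
    Algebra.norm_algebraMap _
  have hd : 0 < Module.finrank ℚ_[C.residueChar] C.k := Module.finrank_pos
  have hss : ((s₀ : ℤ_[C.residueChar]) : ℚ_[C.residueChar]) ^ (Module.finrank ℚ_[C.residueChar] C.k * n) =
      ((s' : ℤ_[C.residueChar]) : ℚ_[C.residueChar]) ^ (Module.finrank ℚ_[C.residueChar] C.k * n) := by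
    rw [pow_mul, pow_mul, ← hNt, ← hNorm, hNs]
  -- (10) through `log_k̄`: `log x₀ = log s'`
  have hssK : (C.padicScalar (s₀ : ℤ_[C.residueChar])) ^ (Module.finrank ℚ_[C.residueChar] C.k * n) =
      (C.padicScalar (s' : ℤ_[C.residueChar])) ^ (Module.finrank ℚ_[C.residueChar] C.k * n) := by
    change (algebraMap C.k C.K (algebraMap ℚ_[C.residueChar] C.k ((s₀ : ℤ_[C.residueChar]) : ℚ_[C.residueChar]))) ^ _ =
      (algebraMap C.k C.K (algebraMap ℚ_[C.residueChar] C.k ((s' : ℤ_[C.residueChar]) : ℚ_[C.residueChar]))) ^ _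
    rw [← map_pow, ← map_pow, ← map_pow, ← map_pow, hss]
  have hlog0 : C.galoisPadicLog.log (C.padicScalar (s₀ : ℤ_[C.residueChar])) =
      C.galoisPadicLog.log (C.padicScalar (s' : ℤ_[C.residueChar])) := by
    have h := congrArg C.galoisPadicLog.log hssK
    rw [C.galoisPadicLog.log_pow hx₀u, C.galoisPadicLog.log_pow hs'U] at h
    exact smul_right_injective C.K (Nat.mul_ne_zero hd.ne' hn.ne') h
  -- (11) `log x₀ = χ_p(γ) · log x₀` with `log x₀ ≠ 0`: `χ_p(γ) = 1`, contradiction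
  have hx₀ne : C.galoisPadicLog.log (C.padicScalar (s₀ : ℤ_[C.residueChar])) ≠ 0 := by
    rw [hs₀]
    exact C.log_one_add_residueChar_ne_zero
  have hc : C.padicScalar (ZHatLevel.padicChar C.residueChar γ) = 1 := by
    have h := hs'
    rw [← hlog0] at h
    exact (mul_left_eq_self₀.mp h.symm).resolve_right hx₀ne
  apply ha
  apply Units.ext
  rw [ZHatLevel.coe_padicCharUnits, Units.val_one]
  exact C.padicScalar_injective (hc.trans (map_one C.padicScalar).symm)

end Producer

end AbsTopMonoids

end Literature.IUT.HodgeArakelov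

end
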